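import Mathlib
import Summits.HodgeConjecture.HodgeConjecture.Theorems.HodgeLocusCensusUnitColumnRankD4
import Summits.HodgeConjecture.HodgeConjecture.Theorems.HodgeLocusCensusInclusionPowers
import Summits.HodgeConjecture.HodgeConjecture.Theorems.HodgeLocusCensusUnitColumnRankD4Levels

/-!
# THEOREM L at `c′ = 1`, EVERY `d = e + 3 ≥ 3`, EVERY level (characteristic `0`) — ENGINE B gen 51 PROBE 5

certified instances and evidence bearing on the general Hodge conjecture; no claim.

`B = K[x₁,…,x_k]/(xᵢ^{e+2})`, `q = Σ xᵢ^{e+1}` (THEOREM K-MODEL), anchor 174's convention with degree AND level freed: rows `v : Fin k → Fin (e+2)`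
of codegree `j` (`Σ v + j = k(e+1)`), columns `m` of codegree `j + (e+1)`, entry `[List.ofFn v ∈ colR (e+3) (List.ofFn m)]` (gen 31's `colR`).
`rank_mulDelta_levels`: `rank = Σ_{μ : Fin k → Fin (e+1)} [e+1 ∣ σ ∧ (e+1)s ≤ σ] · min (C(k−s, σ/(e+1)−s), C(k−s, σ/(e+1)−s+1))`, `σ = j + Σμ`,
`s = #{μ ≠ 0}`; instances of record: anchors 199 (`e = 0`, every level), 174 / 191 (`e = 1`, one level), 219 (`e = 1`, every level).
MECHANISM (THEOREM L; records `gen50/ENGINEB-g50.md` §2–§3, `gen51/ENGINEB-g51.md` §6): the LABEL of a monomial is its exponent function mod `e+1`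
(spectator exponents `1..e` keep their value, the active exponents `0` and `e+1` both read `0`); `×xᵢ^{e+1}` raises one `0` to `e+1`, so labels are
preserved (`mod_eq_of_mem_colR`) and the matrix is a direct sum over labels — anchor 219's `rank_eq_sum_rank_fiber_of` BY NAME (`rank_block`
transports its fibre `{r // (l ↦ r l mod (e+1)) = μ}` to `{r // ∀ l, r l mod (e+1) = μ l}`).  In zero sets inside the `(k−s)`-set `{x // μ x = 0}`
(`t` zeros in a row, `t+1` in a column, `σ = (e+1)(t+s)`: `fiber_arith`, `mem_colR_iff_zeros`, `exists_fiberEquiv`) the block of `μ` is the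
set-inclusion matrix `W^{(1)}_t`: rank `min (C(k−s,t), C(k−s,t+1))` by anchor 204's `rank_incl_pow` BY NAME with `c = 1` (`rank_fiber`); infeasible
labels have no rows (`rank_fiber_zero`).  Imports `Mathlib` + anchors 174 (`ofFn_mem_colR_iff`), 204 (`rank_incl_pow`), 219 (`rank_eq_sum_rank_fiber_of`)
BY NAME; nothing restated; theorem-only, definition-free, no `decide`; characteristic `0` enters only through anchor 204.  Numerics
`gen51/check/levels_lambda.py`: exact ranks of the literal `colR` matrices = this λ-form = gen 50's `s/N_d`-form (`ladder.py`) for `d = 3..7`, `k ≤ 5`,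
every `j` (285/285), = anchors 199 / 219's closed forms at `d = 3, 4`.  Evidence-class material; no census number changes; nothing about HC.
-/

set_option linter.dupNamespace false
set_option autoImplicit false

namespace Summit.HodgeConjecture.HodgeConjecture.HodgeLocus.Census.UnitColumnRankLevels

open Summit.HodgeConjecture.HodgeConjecture.HodgeLocus.Census.ModelNonJumpC1All (colR)
open Summit.HodgeConjecture.HodgeConjecture.HodgeLocus.Census.UnitColumnRankD4 (ofFn_mem_colR_iff)
open Summit.HodgeConjecture.HodgeConjecture.HodgeLocus.Census.InclusionPowers (rank_incl_pow)
open Summit.HodgeConjecture.HodgeConjecture.HodgeLocus.Census.UnitColumnRankD4Levels (rank_eq_sum_rank_fiber_of)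
open Matrix Module

/-- the entry at `d = e + 3` (anchor 174's `ofFn_mem_colR_iff`): `x^v` occurs in `q·x^m` iff `v` is `m` with one zero exponent raised to the top
value `e + 1` -/
theorem mem_colR_iff_raise {k e : ℕ} (m v : Fin k → Fin (e + 2)) :
    List.ofFn (fun l => (v l : ℕ)) ∈ colR (e + 3) (List.ofFn (fun l => (m l : ℕ))) ↔
      ∃ i : Fin k, (m i : ℕ) = 0 ∧ (v i : ℕ) = e + 1 ∧ ∀ l, l ≠ i → v l = m l := by
  rw [ofFn_mem_colR_iff (d := e + 3) m v, show e + 3 - 2 = e + 1 from rfl]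
  exact Iff.rfl

/-- LABELS ARE PRESERVED: if `x^v` occurs in `q·x^m` then `v ≡ m` coordinatewise modulo `e + 1` -/
theorem mod_eq_of_mem_colR {k e : ℕ} (m v : Fin k → Fin (e + 2))
    (h : List.ofFn (fun l => (v l : ℕ)) ∈ colR (e + 3) (List.ofFn (fun l => (m l : ℕ)))) (l : Fin k) :
    (v l : ℕ) % (e + 1) = (m l : ℕ) % (e + 1) := by
  obtain ⟨i, hm0, hv, hoff⟩ := (mem_colR_iff_raise m v).mp h
  by_cases hl : l = i
  · subst hl; rw [hm0, hv, Nat.mod_self, Nat.zero_mod]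
  · rw [hoff l hl]

/-- mass in terms of tops and labels: `Σ v = (e+1)·#{v = e+1} + Σ_l (v l mod (e+1))` -/
theorem sum_eq_tops_add_labels {k e : ℕ} (v : Fin k → Fin (e + 2)) :
    (∑ l, (v l : ℕ)) = (e + 1) * (Finset.univ.filter (fun l => (v l : ℕ) = e + 1)).card + ∑ l, (v l : ℕ) % (e + 1) := by
  have h2 : ∀ l : Fin k, (v l : ℕ) = (e + 1) * (if (v l : ℕ) = e + 1 then 1 else 0) + (v l : ℕ) % (e + 1) := fun l => by
    by_cases h : (v l : ℕ) = e + 1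
    · rw [if_pos h, h, Nat.mod_self]; ring
    · have hlt : (v l : ℕ) < e + 1 := by have := (v l).isLt; omega
      rw [if_neg h, Nat.mod_eq_of_lt hlt]; ring
  calc (∑ l, (v l : ℕ)) = ∑ l, ((e + 1) * (if (v l : ℕ) = e + 1 then 1 else 0) + (v l : ℕ) % (e + 1)) :=
        Finset.sum_congr rfl (fun l _ => h2 l)
    _ = (e + 1) * (Finset.univ.filter (fun l => (v l : ℕ) = e + 1)).card + ∑ l, (v l : ℕ) % (e + 1) := by
        rw [Finset.sum_add_distrib, ← Finset.mul_sum, ← Finset.card_filter]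

/-- zeros, tops and spectators partition the coordinates: `#{v = 0} + #{v = e+1} + #{v mod (e+1) ≠ 0} = k` -/
theorem card_levels {k e : ℕ} (v : Fin k → Fin (e + 2)) :
    (Finset.univ.filter (fun l => (v l : ℕ) = 0)).card + (Finset.univ.filter (fun l => (v l : ℕ) = e + 1)).card
      + (Finset.univ.filter (fun l => (v l : ℕ) % (e + 1) ≠ 0)).card = k := by
  have h2 : ∀ l : Fin k, (if (v l : ℕ) = 0 then 1 else 0) + (if (v l : ℕ) = e + 1 then 1 else 0)
      + (if (v l : ℕ) % (e + 1) ≠ 0 then 1 else 0) = 1 := fun l => by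
    by_cases h0 : (v l : ℕ) = 0
    · have h1 : ¬ ((v l : ℕ) = e + 1) := by omega
      have h3 : ¬ ((v l : ℕ) % (e + 1) ≠ 0) := by rw [h0, Nat.zero_mod]; exact fun h => h rfl
      rw [if_pos h0, if_neg h1, if_neg h3]
    · by_cases ht : (v l : ℕ) = e + 1
      · have h3 : ¬ ((v l : ℕ) % (e + 1) ≠ 0) := by rw [ht, Nat.mod_self]; exact fun h => h rfl
        rw [if_neg h0, if_pos ht, if_neg h3]
      · have hlt : (v l : ℕ) < e + 1 := by have := (v l).isLt; omega
        have h3 : (v l : ℕ) % (e + 1) ≠ 0 := by rw [Nat.mod_eq_of_lt hlt]; exact h0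
        rw [if_neg h0, if_neg ht, if_pos h3]
  have h3 := Finset.sum_congr rfl (fun l (_ : l ∈ (Finset.univ : Finset (Fin k))) => h2 l)
  rw [Finset.sum_add_distrib, Finset.sum_add_distrib, ← Finset.card_filter, ← Finset.card_filter, ← Finset.card_filter] at h3
  simpa using h3

/-- FIBRE ARITHMETIC: a monomial of codegree `a` with labels `μ` has `a + Σμ = (e+1)·(#zeros + s)`, `s = #{μ ≠ 0}` — so `e+1 ∣ a + Σμ`,
`(e+1)s ≤ a + Σμ`, and the number of zeros `t = (a + Σμ)/(e+1) − s` is the same for the whole fibre -/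
theorem fiber_arith {k e a : ℕ} (μ : Fin k → Fin (e + 1)) (v : Fin k → Fin (e + 2))
    (hv : (∑ i, (v i : ℕ)) + a = k * (e + 1)) (hμ : ∀ l, (v l : ℕ) % (e + 1) = (μ l : ℕ)) :
    a + ∑ i, (μ i : ℕ) = (e + 1) * ((Finset.univ.filter (fun l => (v l : ℕ) = 0)).card
      + (Finset.univ.filter (fun l => (μ l : ℕ) ≠ 0)).card) := by
  have hU : (∑ l, (v l : ℕ) % (e + 1)) = ∑ l, (μ l : ℕ) := Finset.sum_congr rfl (fun l _ => hμ l)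
  have hs : Finset.univ.filter (fun l => (v l : ℕ) % (e + 1) ≠ 0) = Finset.univ.filter (fun l => (μ l : ℕ) ≠ 0) :=
    Finset.filter_congr (fun l _ => by rw [hμ l])
  have h1 := sum_eq_tops_add_labels v
  have h2 := card_levels v
  rw [hU] at h1
  rw [hs] at h2
  zify at h1 h2 hv ⊢
  linear_combination hv - h1 - ((e : ℤ) + 1) * h2

/-- the entry in zero sets: for `v`, `m` with the same labels, `x^v` occurs in `q·x^m` iff `Z(v) ⊆ Z(m)` and `|Z(m)| = |Z(v)| + 1` -/
theorem mem_colR_iff_zeros {k e : ℕ} (m v : Fin k → Fin (e + 2)) (hlab : ∀ l, (v l : ℕ) % (e + 1) = (m l : ℕ) % (e + 1)) :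
    List.ofFn (fun l => (v l : ℕ)) ∈ colR (e + 3) (List.ofFn (fun l => (m l : ℕ))) ↔
      (Finset.univ.filter (fun l => (v l : ℕ) = 0) ⊆ Finset.univ.filter (fun l => (m l : ℕ) = 0) ∧
        (Finset.univ.filter (fun l => (m l : ℕ) = 0)).card = (Finset.univ.filter (fun l => (v l : ℕ) = 0)).card + 1) := by
  rw [mem_colR_iff_raise m v]
  constructor
  · rintro ⟨i, hm0, hv, hoff⟩
    have hni : i ∉ Finset.univ.filter (fun l => (v l : ℕ) = 0) := by
      simp only [Finset.mem_filter, Finset.mem_univ, true_and]; omega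
    have hZ : Finset.univ.filter (fun l => (m l : ℕ) = 0) = insert i (Finset.univ.filter (fun l => (v l : ℕ) = 0)) := by
      ext l
      simp only [Finset.mem_filter, Finset.mem_univ, true_and, Finset.mem_insert]
      by_cases hl : l = i
      · subst hl
        exact ⟨fun _ => Or.inl rfl, fun _ => hm0⟩
      · rw [hoff l hl]
        exact ⟨fun h' => Or.inr h', fun h' => h'.resolve_left hl⟩
    refine ⟨?_, ?_⟩
    · rw [hZ]; exact Finset.subset_insert _ _
    · rw [hZ, Finset.card_insert_of_notMem hni]
  · rintro ⟨hsub, hcard⟩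
    have hne : Finset.univ.filter (fun l => (v l : ℕ) = 0) ≠ Finset.univ.filter (fun l => (m l : ℕ) = 0) := fun h' => by
      rw [h'] at hcard; omega
    obtain ⟨i, hiM, hiV⟩ := Finset.exists_of_ssubset (Finset.ssubset_iff_subset_ne.mpr ⟨hsub, hne⟩)
    have hZ : Finset.univ.filter (fun l => (m l : ℕ) = 0) = insert i (Finset.univ.filter (fun l => (v l : ℕ) = 0)) := by
      symm
      apply Finset.eq_of_subset_of_card_le (Finset.insert_subset hiM hsub)
      rw [Finset.card_insert_of_notMem hiV]; omega
    simp only [Finset.mem_filter, Finset.mem_univ, true_and] at hiM hiV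
    have hvi : (v i : ℕ) = e + 1 := by
      have h1 := hlab i
      rw [hiM, Nat.zero_mod] at h1
      by_contra hne'
      have hlt : (v i : ℕ) < e + 1 := by have := (v i).isLt; omega
      rw [Nat.mod_eq_of_lt hlt] at h1
      exact hiV h1
    refine ⟨i, hiM, hvi, fun l hl => Fin.ext ?_⟩
    by_cases hv0 : (v l : ℕ) = 0
    · have hl' : l ∈ Finset.univ.filter (fun l => (m l : ℕ) = 0) := hsub (by simpa using hv0)
      simp only [Finset.mem_filter, Finset.mem_univ, true_and] at hl'
      rw [hv0, hl']
    · have hm0 : (m l : ℕ) ≠ 0 := fun hm0 => by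
        have hl' : l ∈ Finset.univ.filter (fun l => (m l : ℕ) = 0) := by simpa using hm0
        rw [hZ, Finset.mem_insert] at hl'
        rcases hl' with hl' | hl'
        · exact hl hl'
        · simp only [Finset.mem_filter, Finset.mem_univ, true_and] at hl'
          exact hv0 hl'
      have h1 := hlab l
      have hvle : (v l : ℕ) ≤ e + 1 := by have := (v l).isLt; omega
      have hmle : (m l : ℕ) ≤ e + 1 := by have := (m l).isLt; omega
      by_cases hvt : (v l : ℕ) = e + 1
      · by_cases hmt : (m l : ℕ) = e + 1
        · rw [hvt, hmt]
        · rw [hvt, Nat.mod_self, Nat.mod_eq_of_lt (show (m l : ℕ) < e + 1 by omega)] at h1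
          exact absurd h1.symm hm0
      · by_cases hmt : (m l : ℕ) = e + 1
        · rw [hmt, Nat.mod_self, Nat.mod_eq_of_lt (show (v l : ℕ) < e + 1 by omega)] at h1
          exact absurd h1 hv0
        · rwa [Nat.mod_eq_of_lt (show (v l : ℕ) < e + 1 by omega), Nat.mod_eq_of_lt (show (m l : ℕ) < e + 1 by omega)] at h1

/-- THE FIBRE OF A LABEL `μ` at codegree `a` with `a + Σμ = (e+1)(t + s)` is in bijection with the `t`-subsets of the label-zero coordinates
`{x // μ x = 0}` (the zero set), compatibly with the zero-set map (stated as an existence so that the file stays definition-free) -/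
theorem exists_fiberEquiv {k e : ℕ} (μ : Fin k → Fin (e + 1)) (a t : ℕ)
    (hat : a + ∑ i, (μ i : ℕ) = (e + 1) * (t + (Finset.univ.filter (fun l => (μ l : ℕ) ≠ 0)).card)) :
    ∃ eqv : ({r : {v : Fin k → Fin (e + 2) // (∑ i, (v i : ℕ)) + a = k * (e + 1)} // ∀ l, (r.1 l : ℕ) % (e + 1) = (μ l : ℕ)} ≃
           {Z : Finset {x : Fin k // (μ x : ℕ) = 0} // Z.card = t}),
      ∀ r, ((eqv r).1).map (Function.Embedding.subtype (fun x : Fin k => (μ x : ℕ) = 0)) =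
        Finset.univ.filter (fun l => (r.1.1 l : ℕ) = 0) := by
  have hZS : ∀ r : {r : {v : Fin k → Fin (e + 2) // (∑ i, (v i : ℕ)) + a = k * (e + 1)} // ∀ l, (r.1 l : ℕ) % (e + 1) = (μ l : ℕ)},
      ∀ x ∈ Finset.univ.filter (fun l => (r.1.1 l : ℕ) = 0), (μ x : ℕ) = 0 := by
    intro r x hx
    simp only [Finset.mem_filter, Finset.mem_univ, true_and] at hx
    have h := r.2 x
    rw [hx, Nat.zero_mod] at h
    exact h.symm
  have hcard : ∀ r : {r : {v : Fin k → Fin (e + 2) // (∑ i, (v i : ℕ)) + a = k * (e + 1)} // ∀ l, (r.1 l : ℕ) % (e + 1) = (μ l : ℕ)},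
      (Finset.univ.filter (fun l => (r.1.1 l : ℕ) = 0)).card = t := by
    intro r
    have h := fiber_arith μ r.1.1 r.1.2 r.2
    rw [hat] at h
    have h' := Nat.eq_of_mul_eq_mul_left (Nat.succ_pos e) h
    omega
  have hmapμ : ∀ (Z : Finset {x : Fin k // (μ x : ℕ) = 0}) (l : Fin k),
      l ∈ Z.map (Function.Embedding.subtype (fun x : Fin k => (μ x : ℕ) = 0)) → (μ l : ℕ) = 0 := fun Z l hl =>
    Finset.property_of_mem_map_subtype Z hl
  have hsub : ∀ Z : Finset {x : Fin k // (μ x : ℕ) = 0},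
      Z.map (Function.Embedding.subtype (fun x : Fin k => (μ x : ℕ) = 0)) ⊆ Finset.univ.filter (fun l => (μ l : ℕ) = 0) := fun Z l hl => by
    simpa using hmapμ Z l hl
  have hcs : (Finset.univ.filter (fun l => (μ l : ℕ) = 0)).card + (Finset.univ.filter (fun l => (μ l : ℕ) ≠ 0)).card = k := by
    have h := Finset.card_filter_add_card_filter_not (s := (Finset.univ : Finset (Fin k))) (fun l => (μ l : ℕ) = 0)
    simpa using h
  have hspec : ∀ (Z : {Z : Finset {x : Fin k // (μ x : ℕ) = 0} // Z.card = t}) (l : Fin k),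
      (((if l ∈ Z.1.map (Function.Embedding.subtype (fun x : Fin k => (μ x : ℕ) = 0)) then (0 : Fin (e + 2))
        else if (μ l : ℕ) = 0 then Fin.last (e + 1) else Fin.castSucc (μ l)) : Fin (e + 2)) : ℕ) % (e + 1) = (μ l : ℕ) := by
    intro Z l
    by_cases hZ : l ∈ Z.1.map (Function.Embedding.subtype (fun x : Fin k => (μ x : ℕ) = 0))
    · rw [if_pos hZ, Fin.val_zero, Nat.zero_mod, hmapμ Z.1 l hZ]
    · by_cases h0 : (μ l : ℕ) = 0
      · rw [if_neg hZ, if_pos h0, Fin.val_last, Nat.mod_self, h0]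
      · rw [if_neg hZ, if_neg h0, Fin.val_castSucc, Nat.mod_eq_of_lt (μ l).isLt]
  have htops : ∀ Z : {Z : Finset {x : Fin k // (μ x : ℕ) = 0} // Z.card = t},
      Finset.univ.filter (fun l => (((if l ∈ Z.1.map (Function.Embedding.subtype (fun x : Fin k => (μ x : ℕ) = 0)) then (0 : Fin (e + 2))
        else if (μ l : ℕ) = 0 then Fin.last (e + 1) else Fin.castSucc (μ l)) : Fin (e + 2)) : ℕ) = e + 1) =
      Finset.univ.filter (fun l => (μ l : ℕ) = 0) \ Z.1.map (Function.Embedding.subtype (fun x : Fin k => (μ x : ℕ) = 0)) := by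
    intro Z; ext l
    simp only [Finset.mem_filter, Finset.mem_univ, true_and, Finset.mem_sdiff]
    by_cases hZ : l ∈ Z.1.map (Function.Embedding.subtype (fun x : Fin k => (μ x : ℕ) = 0))
    · rw [if_pos hZ, Fin.val_zero]
      exact ⟨fun h => by omega, fun h => absurd hZ h.2⟩
    · by_cases h0 : (μ l : ℕ) = 0
      · rw [if_neg hZ, if_pos h0, Fin.val_last]
        exact ⟨fun _ => ⟨h0, hZ⟩, fun _ => rfl⟩
      · rw [if_neg hZ, if_neg h0, Fin.val_castSucc]
        exact ⟨fun h => by have := (μ l).isLt; omega, fun h => absurd h.1 h0⟩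
  have hlev : ∀ Z : {Z : Finset {x : Fin k // (μ x : ℕ) = 0} // Z.card = t},
      (∑ l, (((if l ∈ Z.1.map (Function.Embedding.subtype (fun x : Fin k => (μ x : ℕ) = 0)) then (0 : Fin (e + 2))
        else if (μ l : ℕ) = 0 then Fin.last (e + 1) else Fin.castSucc (μ l)) : Fin (e + 2)) : ℕ)) + a = k * (e + 1) := by
    intro Z
    have h1 := sum_eq_tops_add_labels (fun l => ((if l ∈ Z.1.map (Function.Embedding.subtype (fun x : Fin k => (μ x : ℕ) = 0))
      then (0 : Fin (e + 2)) else if (μ l : ℕ) = 0 then Fin.last (e + 1) else Fin.castSucc (μ l)) : Fin (e + 2)))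
    have hU : (∑ l, (((if l ∈ Z.1.map (Function.Embedding.subtype (fun x : Fin k => (μ x : ℕ) = 0)) then (0 : Fin (e + 2))
        else if (μ l : ℕ) = 0 then Fin.last (e + 1) else Fin.castSucc (μ l)) : Fin (e + 2)) : ℕ) % (e + 1)) = ∑ l, (μ l : ℕ) :=
      Finset.sum_congr rfl (fun l _ => hspec Z l)
    have hT := congrArg Finset.card (htops Z)
    rw [Finset.card_sdiff_of_subset (hsub Z.1), Finset.card_map, Z.2] at hT
    have htle : t ≤ (Finset.univ.filter (fun l => (μ l : ℕ) = 0)).card := by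
      have := Finset.card_le_card (hsub Z.1); rw [Finset.card_map, Z.2] at this; exact this
    obtain ⟨d0, hd0⟩ := Nat.exists_eq_add_of_le htle
    rw [hU, hT, hd0, Nat.add_sub_cancel_left] at h1
    rw [hd0] at hcs
    zify at h1 hat hcs ⊢
    linear_combination h1 + hat + ((e : ℤ) + 1) * hcs
  refine ⟨{ toFun := fun r => ⟨(Finset.univ.filter (fun l => (r.1.1 l : ℕ) = 0)).subtype (fun x : Fin k => (μ x : ℕ) = 0), by
              rw [← Finset.card_map (Function.Embedding.subtype (fun x : Fin k => (μ x : ℕ) = 0)),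
                Finset.subtype_map_of_mem (hZS r), hcard r]⟩
            invFun := fun Z => ⟨⟨fun l => if l ∈ Z.1.map (Function.Embedding.subtype (fun x : Fin k => (μ x : ℕ) = 0))
                then (0 : Fin (e + 2)) else if (μ l : ℕ) = 0 then Fin.last (e + 1) else Fin.castSucc (μ l), hlev Z⟩, hspec Z⟩
            left_inv := fun r => ?_
            right_inv := fun Z => ?_ }, fun r => ?_⟩
  · apply Subtype.ext; apply Subtype.ext; funext l
    dsimp only
    rw [Finset.subtype_map_of_mem (hZS r)]
    have hμl : (r.1.1 l : ℕ) % (e + 1) = (μ l : ℕ) := r.2 l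
    by_cases h0 : (r.1.1 l : ℕ) = 0
    · have hl : l ∈ Finset.univ.filter (fun l => (r.1.1 l : ℕ) = 0) := by simpa using h0
      rw [if_pos hl]; exact Fin.ext (by rw [Fin.val_zero, h0])
    · have hl : l ∉ Finset.univ.filter (fun l => (r.1.1 l : ℕ) = 0) := by
        simp only [Finset.mem_filter, Finset.mem_univ, true_and]; exact h0
      by_cases ht : (r.1.1 l : ℕ) = e + 1
      · have hμ0 : (μ l : ℕ) = 0 := by rw [← hμl, ht, Nat.mod_self]
        rw [if_neg hl, if_pos hμ0]; exact Fin.ext (by rw [Fin.val_last, ht])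
      · have hlt : (r.1.1 l : ℕ) < e + 1 := by have := (r.1.1 l).isLt; omega
        rw [Nat.mod_eq_of_lt hlt] at hμl
        have hμ0 : ¬ ((μ l : ℕ) = 0) := by rw [← hμl]; exact h0
        rw [if_neg hl, if_neg hμ0]; exact Fin.ext (by rw [Fin.val_castSucc, hμl])
  · apply Subtype.ext
    dsimp only
    ext ⟨x, hx⟩
    simp only [Finset.mem_subtype, Finset.mem_filter, Finset.mem_univ, true_and]
    by_cases hZ : x ∈ Z.1.map (Function.Embedding.subtype (fun x : Fin k => (μ x : ℕ) = 0))
    · have hm : (⟨x, hx⟩ : {x : Fin k // (μ x : ℕ) = 0}) ∈ Z.1 := by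
        rw [Finset.mem_map] at hZ
        obtain ⟨y, hy, hyx⟩ := hZ
        have hy' : y = ⟨x, hx⟩ := Subtype.ext (by simpa using hyx)
        exact hy' ▸ hy
      rw [if_pos hZ]
      exact ⟨fun _ => hm, fun _ => Fin.val_zero _⟩
    · have hm : (⟨x, hx⟩ : {x : Fin k // (μ x : ℕ) = 0}) ∉ Z.1 := fun h' =>
        hZ (Finset.mem_map.mpr ⟨⟨x, hx⟩, h', rfl⟩)
      rw [if_neg hZ, if_pos hx, Fin.val_last]
      exact ⟨fun h => by omega, fun h => absurd h hm⟩
  · exact Finset.subtype_map_of_mem (hZS r)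

/-- THE BLOCK OF A FEASIBLE LABEL: `j + Σμ = (e+1)(t + s)` ⇒ the block is the set-inclusion matrix `W^{(1)}_t` of the `(k − s)`-set
`{x // μ x = 0}` up to reindexing; rank `min (C(k−s,t), C(k−s,t+1))` by anchor 204 (`rank_incl_pow`, characteristic `0`) -/
theorem rank_fiber (K : Type*) [Field K] [CharZero K] (k e j : ℕ) (μ : Fin k → Fin (e + 1)) (t : ℕ)
    (hj : j + ∑ i, (μ i : ℕ) = (e + 1) * (t + (Finset.univ.filter (fun l => (μ l : ℕ) ≠ 0)).card)) :
    (Matrix.of fun (r : {r : {v : Fin k → Fin (e + 2) // (∑ i, (v i : ℕ)) + j = k * (e + 1)} // ∀ l, (r.1 l : ℕ) % (e + 1) = (μ l : ℕ)})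
        (c : {c : {m : Fin k → Fin (e + 2) // (∑ i, (m i : ℕ)) + (j + (e + 1)) = k * (e + 1)} //
          ∀ l, (c.1 l : ℕ) % (e + 1) = (μ l : ℕ)}) =>
      if List.ofFn (fun i => (r.1.1 i : ℕ)) ∈ colR (e + 3) (List.ofFn (fun i => (c.1.1 i : ℕ))) then (1 : K) else 0).rank =
      min ((k - (Finset.univ.filter (fun l => (μ l : ℕ) ≠ 0)).card).choose t)
        ((k - (Finset.univ.filter (fun l => (μ l : ℕ) ≠ 0)).card).choose (t + 1)) := by
  obtain ⟨eR, heR⟩ := exists_fiberEquiv μ j t hj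
  obtain ⟨eC, heC⟩ := exists_fiberEquiv μ (j + (e + 1)) (t + 1) (by simp only [Nat.mul_add, Nat.mul_one] at hj ⊢; omega)
  have hα : Fintype.card {x : Fin k // (μ x : ℕ) = 0} = k - (Finset.univ.filter (fun l => (μ l : ℕ) ≠ 0)).card := by
    have h := Finset.card_filter_add_card_filter_not (s := (Finset.univ : Finset (Fin k))) (fun l => (μ l : ℕ) = 0)
    rw [Fintype.card_subtype]
    simp only [Finset.card_univ, Fintype.card_fin, ne_eq] at h ⊢
    omega
  have key : (Matrix.of fun (r : {r : {v : Fin k → Fin (e + 2) // (∑ i, (v i : ℕ)) + j = k * (e + 1)} //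
          ∀ l, (r.1 l : ℕ) % (e + 1) = (μ l : ℕ)})
        (c : {c : {m : Fin k → Fin (e + 2) // (∑ i, (m i : ℕ)) + (j + (e + 1)) = k * (e + 1)} //
          ∀ l, (c.1 l : ℕ) % (e + 1) = (μ l : ℕ)}) =>
      if List.ofFn (fun i => (r.1.1 i : ℕ)) ∈ colR (e + 3) (List.ofFn (fun i => (c.1.1 i : ℕ))) then (1 : K) else 0) =
      Matrix.reindex eR.symm eC.symm (Matrix.of fun (T : {Z : Finset {x : Fin k // (μ x : ℕ) = 0} // Z.card = t})
        (U : {Z : Finset {x : Fin k // (μ x : ℕ) = 0} // Z.card = t + 1}) => if T.1 ⊆ U.1 then (1 : K) else 0) := by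
    ext r c
    simp only [Matrix.reindex_apply, Equiv.symm_symm, Matrix.submatrix_apply, Matrix.of_apply]
    refine if_congr ?_ rfl rfl
    rw [mem_colR_iff_zeros c.1.1 r.1.1 (fun l => (r.2 l).trans (c.2 l).symm), ← heR r, ← heC c, Finset.map_subset_map,
      Finset.card_map, Finset.card_map, (eR r).2, (eC c).2]
    exact ⟨fun h => h.1, fun h => ⟨h, rfl⟩⟩
  rw [key, Matrix.rank_reindex, rank_incl_pow K (α := {x : Fin k // (μ x : ℕ) = 0}) t 1, hα]

/-- an INFEASIBLE label (`e+1 ∤ j + Σμ` or `j + Σμ < (e+1)s`) has no rows at codegree `j`: block rank `0` -/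
theorem rank_fiber_zero (K : Type*) [Field K] (k e j : ℕ) (μ : Fin k → Fin (e + 1))
    (h : ¬ ((e + 1) ∣ (j + ∑ i, (μ i : ℕ)) ∧ (e + 1) * (Finset.univ.filter (fun l => (μ l : ℕ) ≠ 0)).card ≤ j + ∑ i, (μ i : ℕ))) :
    (Matrix.of fun (r : {r : {v : Fin k → Fin (e + 2) // (∑ i, (v i : ℕ)) + j = k * (e + 1)} // ∀ l, (r.1 l : ℕ) % (e + 1) = (μ l : ℕ)})
        (c : {c : {m : Fin k → Fin (e + 2) // (∑ i, (m i : ℕ)) + (j + (e + 1)) = k * (e + 1)} //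
          ∀ l, (c.1 l : ℕ) % (e + 1) = (μ l : ℕ)}) =>
      if List.ofFn (fun i => (r.1.1 i : ℕ)) ∈ colR (e + 3) (List.ofFn (fun i => (c.1.1 i : ℕ))) then (1 : K) else 0).rank = 0 := by
  haveI : IsEmpty {r : {v : Fin k → Fin (e + 2) // (∑ i, (v i : ℕ)) + j = k * (e + 1)} // ∀ l, (r.1 l : ℕ) % (e + 1) = (μ l : ℕ)} :=
    ⟨fun r => h (by
      have h1 := fiber_arith μ r.1.1 r.1.2 r.2
      exact ⟨⟨_, h1⟩, by rw [h1]; exact Nat.mul_le_mul_left _ (Nat.le_add_left _ _)⟩)⟩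
  have hle := Matrix.rank_le_card_height (Matrix.of fun
      (r : {r : {v : Fin k → Fin (e + 2) // (∑ i, (v i : ℕ)) + j = k * (e + 1)} // ∀ l, (r.1 l : ℕ) % (e + 1) = (μ l : ℕ)})
      (c : {c : {m : Fin k → Fin (e + 2) // (∑ i, (m i : ℕ)) + (j + (e + 1)) = k * (e + 1)} //
        ∀ l, (c.1 l : ℕ) % (e + 1) = (μ l : ℕ)}) =>
      if List.ofFn (fun i => (r.1.1 i : ℕ)) ∈ colR (e + 3) (List.ofFn (fun i => (c.1.1 i : ℕ))) then (1 : K) else 0)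
  rw [Fintype.card_eq_zero] at hle
  omega

/-- THE BLOCK OF A LABEL `μ` in the engine's fibre form `{r // (l ↦ r l mod (e+1)) = μ}` (anchor 219's `rank_eq_sum_rank_fiber_of`), transported
to the arithmetic fibre: rank `[e+1 ∣ σ ∧ (e+1)s ≤ σ] · min (C(k−s, σ/(e+1) − s), C(k−s, σ/(e+1) − s + 1))`, `σ = j + Σμ` -/
theorem rank_block (K : Type*) [Field K] [CharZero K] (k e j : ℕ) (μ : Fin k → Fin (e + 1)) :
    (Matrix.of fun (r : {r : {v : Fin k → Fin (e + 2) // (∑ i, (v i : ℕ)) + j = k * (e + 1)} //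
          (fun l => (⟨(r.1 l : ℕ) % (e + 1), Nat.mod_lt _ (Nat.succ_pos e)⟩ : Fin (e + 1))) = μ})
        (c : {c : {m : Fin k → Fin (e + 2) // (∑ i, (m i : ℕ)) + (j + (e + 1)) = k * (e + 1)} //
          (fun l => (⟨(c.1 l : ℕ) % (e + 1), Nat.mod_lt _ (Nat.succ_pos e)⟩ : Fin (e + 1))) = μ}) =>
      if List.ofFn (fun i => (r.1.1 i : ℕ)) ∈ colR (e + 3) (List.ofFn (fun i => (c.1.1 i : ℕ))) then (1 : K) else 0).rank =
      (if (e + 1) ∣ (j + ∑ i, (μ i : ℕ)) ∧ (e + 1) * (Finset.univ.filter (fun l => (μ l : ℕ) ≠ 0)).card ≤ j + ∑ i, (μ i : ℕ) then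
          min ((k - (Finset.univ.filter (fun l => (μ l : ℕ) ≠ 0)).card).choose
                ((j + ∑ i, (μ i : ℕ)) / (e + 1) - (Finset.univ.filter (fun l => (μ l : ℕ) ≠ 0)).card))
            ((k - (Finset.univ.filter (fun l => (μ l : ℕ) ≠ 0)).card).choose
                ((j + ∑ i, (μ i : ℕ)) / (e + 1) - (Finset.univ.filter (fun l => (μ l : ℕ) ≠ 0)).card + 1))
        else 0) := by
  have hiff : ∀ w : Fin k → Fin (e + 2), ((fun l => (⟨(w l : ℕ) % (e + 1), Nat.mod_lt _ (Nat.succ_pos e)⟩ : Fin (e + 1))) = μ) ↔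
      ∀ l, (w l : ℕ) % (e + 1) = (μ l : ℕ) := fun w =>
    ⟨fun h l => Fin.ext_iff.mp (congrFun h l), fun h => funext fun l => Fin.ext (h l)⟩
  have key : (Matrix.of fun (r : {r : {v : Fin k → Fin (e + 2) // (∑ i, (v i : ℕ)) + j = k * (e + 1)} //
          (fun l => (⟨(r.1 l : ℕ) % (e + 1), Nat.mod_lt _ (Nat.succ_pos e)⟩ : Fin (e + 1))) = μ})
        (c : {c : {m : Fin k → Fin (e + 2) // (∑ i, (m i : ℕ)) + (j + (e + 1)) = k * (e + 1)} //
          (fun l => (⟨(c.1 l : ℕ) % (e + 1), Nat.mod_lt _ (Nat.succ_pos e)⟩ : Fin (e + 1))) = μ}) =>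
      if List.ofFn (fun i => (r.1.1 i : ℕ)) ∈ colR (e + 3) (List.ofFn (fun i => (c.1.1 i : ℕ))) then (1 : K) else 0) =
      Matrix.reindex
        (Equiv.subtypeEquivRight (fun (r : {v : Fin k → Fin (e + 2) // (∑ i, (v i : ℕ)) + j = k * (e + 1)}) => hiff r.1)).symm
        (Equiv.subtypeEquivRight (fun (c : {m : Fin k → Fin (e + 2) // (∑ i, (m i : ℕ)) + (j + (e + 1)) = k * (e + 1)}) => hiff c.1)).symm
        (Matrix.of fun (r : {r : {v : Fin k → Fin (e + 2) // (∑ i, (v i : ℕ)) + j = k * (e + 1)} //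
            ∀ l, (r.1 l : ℕ) % (e + 1) = (μ l : ℕ)})
          (c : {c : {m : Fin k → Fin (e + 2) // (∑ i, (m i : ℕ)) + (j + (e + 1)) = k * (e + 1)} //
            ∀ l, (c.1 l : ℕ) % (e + 1) = (μ l : ℕ)}) =>
          if List.ofFn (fun i => (r.1.1 i : ℕ)) ∈ colR (e + 3) (List.ofFn (fun i => (c.1.1 i : ℕ))) then (1 : K) else 0) := by
    ext r c
    simp only [Matrix.reindex_apply, Equiv.symm_symm, Matrix.submatrix_apply, Matrix.of_apply, Equiv.subtypeEquivRight_apply_coe]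
  rw [key, Matrix.rank_reindex]
  by_cases h : (e + 1) ∣ (j + ∑ i, (μ i : ℕ)) ∧ (e + 1) * (Finset.univ.filter (fun l => (μ l : ℕ) ≠ 0)).card ≤ j + ∑ i, (μ i : ℕ)
  · rw [if_pos h]
    obtain ⟨⟨c, hc⟩, hle⟩ := h
    rw [hc] at hle
    have hcs : (Finset.univ.filter (fun l => (μ l : ℕ) ≠ 0)).card ≤ c := Nat.le_of_mul_le_mul_left hle (Nat.succ_pos e)
    rw [hc, Nat.mul_div_cancel_left c (Nat.succ_pos e)]
    exact rank_fiber K k e j μ (c - (Finset.univ.filter (fun l => (μ l : ℕ) ≠ 0)).card) (by rw [Nat.sub_add_cancel hcs]; exact hc)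
  · rw [if_neg h]
    exact rank_fiber_zero K k e j μ h

/-- **THEOREM L at `c′ = 1`, every `d = e + 3 ≥ 3`, every level** (`B = K[x₁,…,x_k]/(xᵢ^{e+2})`, `q = Σ xᵢ^{e+1}`, `char K = 0`), in anchor
174's convention: `rank (×q : B_{k(e+1)−j−(e+1)} → B_{k(e+1)−j})`
`= Σ_{μ : Fin k → Fin (e+1)} [e+1 ∣ σ ∧ (e+1)s ≤ σ] · min (C(k−s, σ/(e+1)−s), C(k−s, σ/(e+1)−s+1))`, `σ = j + Σμ`, `s = #{μ ≠ 0}`. -/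
theorem rank_mulDelta_levels (K : Type*) [Field K] [CharZero K] (k e j : ℕ) :
    (Matrix.of fun (v : {v : Fin k → Fin (e + 2) // (∑ i, (v i : ℕ)) + j = k * (e + 1)})
        (m : {m : Fin k → Fin (e + 2) // (∑ i, (m i : ℕ)) + (j + (e + 1)) = k * (e + 1)}) =>
      if List.ofFn (fun i => (v.1 i : ℕ)) ∈ colR (e + 3) (List.ofFn (fun i => (m.1 i : ℕ))) then (1 : K) else 0).rank =
      ∑ μ : Fin k → Fin (e + 1),
        (if (e + 1) ∣ (j + ∑ i, (μ i : ℕ)) ∧ (e + 1) * (Finset.univ.filter (fun l => (μ l : ℕ) ≠ 0)).card ≤ j + ∑ i, (μ i : ℕ) then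
            min ((k - (Finset.univ.filter (fun l => (μ l : ℕ) ≠ 0)).card).choose
                  ((j + ∑ i, (μ i : ℕ)) / (e + 1) - (Finset.univ.filter (fun l => (μ l : ℕ) ≠ 0)).card))
              ((k - (Finset.univ.filter (fun l => (μ l : ℕ) ≠ 0)).card).choose
                  ((j + ∑ i, (μ i : ℕ)) / (e + 1) - (Finset.univ.filter (fun l => (μ l : ℕ) ≠ 0)).card + 1))
          else 0) := by
  rw [rank_eq_sum_rank_fiber_of (K := K) (ι := Fin k → Fin (e + 1))
    (fun (v : {v : Fin k → Fin (e + 2) // (∑ i, (v i : ℕ)) + j = k * (e + 1)})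
        (m : {m : Fin k → Fin (e + 2) // (∑ i, (m i : ℕ)) + (j + (e + 1)) = k * (e + 1)}) =>
      if List.ofFn (fun i => (v.1 i : ℕ)) ∈ colR (e + 3) (List.ofFn (fun i => (m.1 i : ℕ))) then (1 : K) else 0)
    (fun v l => (⟨(v.1 l : ℕ) % (e + 1), Nat.mod_lt _ (Nat.succ_pos e)⟩ : Fin (e + 1)))
    (fun m l => (⟨(m.1 l : ℕ) % (e + 1), Nat.mod_lt _ (Nat.succ_pos e)⟩ : Fin (e + 1)))
    (fun v m hvm => if_neg (fun h => hvm (funext fun l => Fin.ext (mod_eq_of_mem_colR m.1 v.1 h l))))]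
  exact Finset.sum_congr rfl (fun μ _ => rank_block K k e j μ)

end Summit.HodgeConjecture.HodgeConjecture.HodgeLocus.Census.UnitColumnRankLevels
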